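import Literature.AlgebraicGeometry.Motives.AbelianVarietyFrobeniusKernelAnnihilator
import Literature.AlgebraicGeometry.GroupSchemes.CartierDualAnnihilatorRank
import Literature.AlgebraicGeometry.GroupSchemes.EtaleOfTrivialUnitComponent
import Literature.AlgebraicGeometry.AbelianSchemes.WeilDualityPolarizationTransport
import Literature.AlgebraicGeometry.AbelianSchemes.DualIsogenyDegree
import HarnessLib

/-!
# A polarization of degree prime to `p` kills no non-trivial point of `A[p^r]` (the all-`T` clause `hlam` of the W-line head)

Layer `Literature/AlgebraicGeometry/AbelianSchemes`, namespace `Literature.AlgebraicGeometry.AbelianSchemes.AbelianSchemeOver.DualPair` (§0 bricks in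
`Literature.AlgebraicGeometry.GroupSchemes.AffineGroupScheme`).  THEOREMS ONLY (no definition, no named fact, no instance, no notation, no `sorry`).
Cell `hodgecm-mathlib`, programme P6 «MOD», GEN leaf (o1) of LEAD «M-17u» (3) (2026-09-01): the hypothesis
`hlam : ∀ T (t : T ⟶ G), (t ≫ j) ≫ λ = 1 → t = 1` of the head type `WeilCartierDualityLagrangian` (`Cruxes/HLiu418/Lines/F0_P6b_WeilCartierDuality.lean`)
from «`deg λ` prime to `p`», in the ★-dockable currency `IsIsogeny (homOfIsMonHom λ)` + `(Hom.kerRank (homOfIsMonHom λ)).Coprime p`.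
`--supports stmt-HodgeConjecture-24832`, count-neutral.  HC_CM is proved only modulo the printed citations until rung 0 closes.

## Mathematics ([MumfordAV1970] §6 App. 3, §23; [Tate1997FiniteFlatGroupSchemes] (3.7))

`k` perfect of characteristic `p`, `q = p^r`, `j : G ↪ A` a realisation of `A[q]` (all-`T` points), `λ : A → Â` an isogeny of degree
`kerRank λ` prime to `p`.  The closed subgroup `K := Ker (j ≫ λ) ⊂ G` has rank dividing `rk G = q^{2 dim A}` (★ `finrank_alg_eq_of_realises_torsion`,
Lagrange ★ `finrank_alg_dvd_of_isClosedImmersion`), so `rk K = p^i`; it embeds as a closed subgroup of `Ker λ`, so `rk K ∣ kerRank λ`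
(★ `hom_finrank_eq_finrank_alg`, ★ `finrank_ker_hom_of_isIsogeny`), which is prime to `p`; hence `rk K = 1`, `K = Spec k`
(★ `isIso_hom_of_finrank_eq_one`), and every `T`-point of `G` killed by `λ` — a `T`-point of `K` — is trivial.

* §0 `eq_one_of_finrank_alg_eq_one` — a `T`-point of an affine `k`-group scheme of rank one is trivial.
* §1 `finrank_alg_ker_comp_dvd_pow` (`rk K ∣ q^{2 dim A}`), `finrank_alg_ker_comp_dvd_kerRank` (`rk K ∣ kerRank λ`),
  `finrank_alg_ker_comp_eq_one` (`rk K = 1`).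
* §2 HEAD **`comp_lam_eq_one_imp_eq_one_of_coprime`** — conclusion VERBATIM the binder `hlam` of the head type.

## References
* [MumfordAV1970] D. Mumford, *Abelian Varieties* (1970), §6 Application 3 (p. 64), §23.
* [Tate1997FiniteFlatGroupSchemes] J. Tate, *Finite flat group schemes* (1997), (3.7) (Lagrange for finite group schemes).
* [Waterhouse1979] W. C. Waterhouse, *Introduction to Affine Group Schemes* (1979), §14.1.
* [StacksProject] Tag 02KA.
-/

set_option autoImplicit false

-- Mathlib's `Over`/`Scheme` APIs are stated across semireducible wrappers (as in the ★ `GroupSchemes/*` files).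
set_option backward.isDefEq.respectTransparency false

noncomputable section

universe u

open CategoryTheory CategoryTheory.Limits AlgebraicGeometry MonoidalCategory CartesianMonoidalCategory
open scoped MonObj

/-! ## §0 A rank-one affine `k`-group scheme has only the trivial point -/

namespace Literature.AlgebraicGeometry.GroupSchemes.AffineGroupScheme

open Literature.AlgebraicGeometry.Motives

/-- **A `T`-point of an affine `k`-group scheme `K` with `dim_k Γ(K) = 1` is trivial**: `K → Spec k` is an isomorphism (★
`isIso_hom_of_finrank_eq_one` for the presentation `K ≅ Spec Γ(K)`), so any two `T`-points of `K` over `k` coincide.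
[cite: StacksProject, Tag 02KA] -/
theorem eq_one_of_finrank_alg_eq_one {k : Type u} [Field k] (K : SchemeOver k) [GrpObj K] [IsAffine K.left]
    (h1 : Module.finrank k (Alg K) = 1) {T : SchemeOver k} (t : T ⟶ K) : t = 1 := by
  haveI : IsIso K.hom :=
    isIso_hom_of_finrank_eq_one K (Alg K) K.left.isoSpec (isoSpec_hom_comp_SpecMap_algebraMapΓ K.hom) h1
  ext : 1
  rw [← cancel_mono K.hom, Over.w t, Over.w (1 : T ⟶ K)]

end Literature.AlgebraicGeometry.GroupSchemes.AffineGroupScheme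

namespace Literature.AlgebraicGeometry.AbelianSchemes

namespace AbelianSchemeOver

namespace DualPair

open Literature.AlgebraicGeometry.GroupSchemes Literature.AlgebraicGeometry.GroupSchemes.GroupSchemeKernel
open Literature.AlgebraicGeometry.GroupSchemes.AffineGroupScheme
open Literature.AlgebraicGeometry.Motives Literature.AlgebraicGeometry.Motives.AbelianVariety

variable {k : Type u} [Field k]

/-! ## §1 The rank of `K := Ker (j ≫ λ) ⊂ A[q]` -/

/-- **`rk Γ(Ker (j ≫ λ)) ∣ q^{2 dim A}`**: `Ker (j ≫ λ)` is a closed subgroup of the realisation `G ≅ A[q]`, whose rank is `q^{2 dim A}`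
(★ `finrank_alg_eq_of_realises_torsion`; Lagrange ★ `finrank_alg_dvd_of_isClosedImmersion`). [cite: Tate1997FiniteFlatGroupSchemes, (3.7)]
[cite: MumfordAV1970, §6 Application 3 (p. 64)] -/
theorem finrank_alg_ker_comp_dvd_pow [PerfectField k] (p : ℕ) [Fact p.Prime] [CharP k p] (r : ℕ) (A : AbelianVariety k)
    (D : (AbelianScheme.ofAbelianVariety A).toOver.DualPair) (lam : (AbelianScheme.ofAbelianVariety A).toOver.X ⟶ D.hat.X) [IsMonHom lam]
    {G : SchemeOver k} [GrpObj G] [IsCommMonObj G] [IsAffine G.left] [Module.Finite k (Alg G)]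
    (j : G ⟶ A.X) [IsMonHom j] [IsClosedImmersion j.left]
    (hG : ∀ ⦃T : SchemeOver k⦄ (t : T ⟶ A.X), (∃ s : T ⟶ G, s ≫ j = t) ↔ t ≫ ((((p ^ r : ℕ) : ℤ) • 𝟙 A).hom.hom.hom) = 1)
    [IsAffine (ker (j ≫ lam)).left] [Module.Finite k (Alg (ker (j ≫ lam)))] [IsCommMonObj (ker (j ≫ lam))]
    [IsClosedImmersion (kerι (j ≫ lam)).left] :
    Module.finrank k (Alg (ker (j ≫ lam))) ∣ (p ^ r) ^ (2 * A.dim) := by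
  haveI := mono_of_isClosedImmersion_left j
  rw [← finrank_alg_eq_of_realises_torsion p r A G j hG]
  exact finrank_alg_dvd_of_isClosedImmersion (kerι (j ≫ lam))

/-- **`rk Γ(Ker (j ≫ λ)) ∣ kerRank λ`**: `Ker (j ≫ λ)` embeds into `Ker λ` as a closed subgroup (★ `kerLift` of `ι ≫ j`), and
`rk Γ(Ker λ) = kerRank λ` for the isogeny `λ` (★ `hom_finrank_eq_finrank_alg`, ★ `finrank_ker_hom_of_isIsogeny`).
[cite: Tate1997FiniteFlatGroupSchemes, (3.7)] [cite: MumfordAV1970, §6 Application 3 (p. 64)] -/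
theorem finrank_alg_ker_comp_dvd_kerRank [PerfectField k] (A : AbelianVariety k)
    (D : (AbelianScheme.ofAbelianVariety A).toOver.DualPair) (lam : (AbelianScheme.ofAbelianVariety A).toOver.X ⟶ D.hat.X) [IsMonHom lam]
    {G : SchemeOver k} [GrpObj G] [IsCommMonObj G] [IsAffine G.left] [Module.Finite k (Alg G)]
    (j : G ⟶ A.X) [IsMonHom j] [IsClosedImmersion j.left]
    (hiso : IsIsogeny (homOfIsMonHom (A' := (AbelianScheme.ofAbelianVariety A).toOver) (B := D.hat)
      lam))
    [IsAffine (ker (j ≫ lam)).left] [Module.Finite k (Alg (ker (j ≫ lam)))]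
    [IsCommMonObj (ker (j ≫ lam))] [IsClosedImmersion (kerι (j ≫ lam)).left] :
    Module.finrank k (Alg (ker (j ≫ lam))) ∣
      Hom.kerRank (homOfIsMonHom (A' := (AbelianScheme.ofAbelianVariety A).toOver) (B := D.hat) lam) := by
  -- the kernel of `λ` as a finite commutative affine `k`-group scheme
  haveI : IsCommMonObj (AbelianScheme.ofAbelianVariety A).toOver.X := inferInstanceAs (IsCommMonObj A.X)
  haveI : IsFinite lam.left := hiso.2
  haveI : IsFinite (ker lam).hom := isFinite_ker_hom_of_isFinite_left lam
  haveI : IsAffine (ker lam).left := isAffine_of_isAffineHom (ker lam).hom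
  haveI : Module.Finite k (Alg (ker lam)) := Alg.moduleFinite (ker lam)
  haveI : IsCommMonObj (ker lam) := isCommMonObj_ker lam
  haveI : IsSeparated D.hat.X.hom := inferInstanceAs (IsSeparated D.hat.toAffine.toAbelianVariety.X.hom)
  haveI : IsClosedImmersion (kerι lam).left := isClosedImmersion_kerι_left_of_isSeparated lam
  -- the comparison `u : Ker (j ≫ λ) → Ker λ`, a closed immersion and a homomorphism
  have hu0 : (kerι (j ≫ lam) ≫ j) ≫ lam = 1 := by rw [Category.assoc, kerι_comp]
  haveI := isMonHom_kerLift (f := lam) (kerι (j ≫ lam) ≫ j) hu0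
  haveI : IsClosedImmersion (kerLift (f := lam) (kerι (j ≫ lam) ≫ j) hu0).left := by
    haveI : IsClosedImmersion ((kerLift (f := lam) (kerι (j ≫ lam) ≫ j) hu0).left ≫ (kerι lam).left) := by
      rw [← Over.comp_left, kerLift_ι, Over.comp_left]
      infer_instance
    exact IsClosedImmersion.of_comp _ (kerι lam).left
  have hdvd := finrank_alg_dvd_of_isClosedImmersion (kerLift (f := lam) (kerι (j ≫ lam) ≫ j) hu0)
  obtain ⟨pt⟩ : Nonempty ↥(Spec (CommRingCat.of k)) := inferInstance
  have hrk : Module.finrank k (Alg (ker lam)) =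
      Hom.kerRank (homOfIsMonHom (A' := (AbelianScheme.ofAbelianVariety A).toOver) (B := D.hat) lam) := by
    rw [← hom_finrank_eq_finrank_alg _ pt]
    exact finrank_ker_hom_of_isIsogeny _ hiso pt
  rwa [hrk] at hdvd

/-- **`rk Γ(Ker (j ≫ λ)) = 1`** when `deg λ = kerRank λ` is prime to `p`: the rank is a power of `p` (it divides `q^{2 dim A}`) dividing a
number prime to `p`. [cite: MumfordAV1970, §23] [cite: Tate1997FiniteFlatGroupSchemes, (3.7)] -/
theorem finrank_alg_ker_comp_eq_one [PerfectField k] (p : ℕ) [Fact p.Prime] [CharP k p] (r : ℕ) (A : AbelianVariety k)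
    (D : (AbelianScheme.ofAbelianVariety A).toOver.DualPair) (lam : (AbelianScheme.ofAbelianVariety A).toOver.X ⟶ D.hat.X) [IsMonHom lam]
    {G : SchemeOver k} [GrpObj G] [IsCommMonObj G] [IsAffine G.left] [Module.Finite k (Alg G)]
    (j : G ⟶ A.X) [IsMonHom j] [IsClosedImmersion j.left]
    (hG : ∀ ⦃T : SchemeOver k⦄ (t : T ⟶ A.X), (∃ s : T ⟶ G, s ≫ j = t) ↔ t ≫ ((((p ^ r : ℕ) : ℤ) • 𝟙 A).hom.hom.hom) = 1)
    (hiso : IsIsogeny (homOfIsMonHom (A' := (AbelianScheme.ofAbelianVariety A).toOver) (B := D.hat)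
      lam))
    (hcop : (Hom.kerRank (homOfIsMonHom (A' := (AbelianScheme.ofAbelianVariety A).toOver) (B := D.hat)
      lam)).Coprime p)
    [IsAffine (ker (j ≫ lam)).left] [Module.Finite k (Alg (ker (j ≫ lam)))]
    [IsCommMonObj (ker (j ≫ lam))] [IsClosedImmersion (kerι (j ≫ lam)).left] :
    Module.finrank k (Alg (ker (j ≫ lam))) = 1 := by
  have hp : p.Prime := Fact.out
  have h1 := finrank_alg_ker_comp_dvd_pow p r A D lam j hG
  rw [← pow_mul] at h1
  obtain ⟨i, -, hi⟩ := (Nat.dvd_prime_pow hp).1 h1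
  have h2 := finrank_alg_ker_comp_dvd_kerRank A D lam j hiso
  rw [hi] at h2 ⊢
  rcases Nat.eq_zero_or_pos i with h0 | hpos
  · rw [h0, pow_zero]
  · exfalso
    have hpd : p ∣ Hom.kerRank (homOfIsMonHom (A' := (AbelianScheme.ofAbelianVariety A).toOver) (B := D.hat) lam) :=
      (dvd_pow_self p hpos.ne').trans h2
    exact hp.one_lt.ne' ((Nat.coprime_comm.1 hcop).eq_one_of_dvd hpd)

/-! ## §2 Head -/

/-- **A POLARIZATION OF DEGREE PRIME TO `p` KILLS NO NON-TRIVIAL POINT OF `A[p^r]`** — the binder `hlam` of the W-line head type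
`WeilCartierDualityLagrangian`: over a perfect field `k` of characteristic `p`, for an abelian variety `A` with a dual pair `D` and a polarization
`λ = lam` which is an isogeny (`hiso`, ★ `IsLambdaOfAt.isIsogeny_fibreHom_of_isAmple_of_dim_eq` at a fibre) of degree `kerRank λ` prime to
`p` (`hcop`), and a realisation `j : G ↪ A` of `A[p^r]` (all-`T` points), every `T`-point `t` of `G` with `(t ≫ j) ≫ λ = 1` is trivial:
`t` is a `T`-point of `K = Ker (j ≫ λ)`, of rank `1` (§1), hence `Spec k` (§0). [cite: MumfordAV1970, §6 Application 3 (p. 64), §23]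
[cite: Tate1997FiniteFlatGroupSchemes, (3.7)] -/
theorem comp_lam_eq_one_imp_eq_one_of_coprime [PerfectField k] (p : ℕ) [Fact p.Prime] [CharP k p] (r : ℕ) (A : AbelianVariety k)
    (D : (AbelianScheme.ofAbelianVariety A).toOver.DualPair) (lam : (AbelianScheme.ofAbelianVariety A).toOver.X ⟶ D.hat.X) [IsMonHom lam]
    {G : SchemeOver k} [GrpObj G] [IsCommMonObj G] [IsAffine G.left] [Module.Free k (Alg G)] [Module.Finite k (Alg G)]
    (j : G ⟶ A.X) [IsMonHom j] [IsClosedImmersion j.left]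
    (hG : ∀ ⦃T : SchemeOver k⦄ (t : T ⟶ A.X), (∃ s : T ⟶ G, s ≫ j = t) ↔ t ≫ ((((p ^ r : ℕ) : ℤ) • 𝟙 A).hom.hom.hom) = 1)
    (hiso : IsIsogeny (homOfIsMonHom (A' := (AbelianScheme.ofAbelianVariety A).toOver) (B := D.hat)
      lam))
    (hcop : (Hom.kerRank (homOfIsMonHom (A' := (AbelianScheme.ofAbelianVariety A).toOver) (B := D.hat)
      lam)).Coprime p)
    ⦃T : SchemeOver k⦄ (t : T ⟶ G) (ht : (t ≫ j) ≫ lam = 1) : t = 1 := by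
  -- `K := Ker (j ≫ λ)` as a finite commutative affine closed subgroup of `G`
  haveI : IsFinite G.hom := isFinite_hom_of_finite_alg G
  haveI : IsSeparated D.hat.X.hom := inferInstanceAs (IsSeparated D.hat.toAffine.toAbelianVariety.X.hom)
  haveI : IsClosedImmersion (kerι (j ≫ lam)).left := isClosedImmersion_kerι_left_of_isSeparated (j ≫ lam)
  haveI : IsFinite (ker (j ≫ lam)).hom := by
    rw [← Over.w (kerι (j ≫ lam))]
    infer_instance
  haveI : IsAffine (ker (j ≫ lam)).left := isAffine_of_isAffineHom (kerι (j ≫ lam)).left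
  haveI : Module.Finite k (Alg (ker (j ≫ lam))) := Alg.moduleFinite (ker (j ≫ lam))
  haveI : IsCommMonObj (ker (j ≫ lam)) := isCommMonObj_ker (j ≫ lam)
  have hK1 := finrank_alg_ker_comp_eq_one p r A D lam j hG hiso hcop
  -- `t` is a `T`-point of `K`, and `K` has only the trivial point
  have ht' : t ≫ (j ≫ lam) = 1 := by rw [← Category.assoc, ht]
  have hs := eq_one_of_finrank_alg_eq_one (ker (j ≫ lam)) hK1 (kerLift t ht')
  rw [← kerLift_ι t ht', hs, MonObj.one_comp]

end DualPair

end AbelianSchemeOver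

end Literature.AlgebraicGeometry.AbelianSchemes

end
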